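import Summits.NavierStokesRegularity.NavierStokesRegularity.Theorems.ArgmaxNearDoorsDefs
import Literature.NumberTheory.Sieve.LinearEquationsInPrimesSieveTau
import HarnessLib

/-!
# ArgmaxNearDoorsCompositions — S36 §A «ArgmaxNearDoors»: the proved support (§4) and the composition of door
# C♭ (§5, first half) — plate P0-36A part 2 of 3, VERBATIM from the sketch

LANDING NOTE: `HOME/ns-regularity-ideate-p1/r34/Sketch36A.lean` sha16 3ebc53b38700dd90, lines 187–417 byte-identical except that the sketch's local lemma
`exp_le_one_add_two_mul` is replaced by the identical landed `Literature.NumberTheory.Sieve.exp_le_one_add_two_mul`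
(gate dedup rule) (LEAD S-door ns-s30-p1 g3; the sketch is split in three only because the gate caps Theorems files with proofs at 400
lines: part 1 `ArgmaxNearDoorsDefs` = §0–§3, part 3 `ArgmaxNearDoorsCompositionsShrinking` = §5 second half + §6).
`--supports stmt-NavierStokesRegularity-0056 --as helper`.

## The sketch header (verbatim)

The far field of the stretching rate at a vorticity argmax is PAID BY LERAY'S ENERGY INEQUALITY
(LEAD ns-s30-p1 g3, 16:11:15Z; tools `ArgmaxDoorsNearEngine` E♭/N♭, ns-sfl-p1 g5 `ArgmaxDoorsDepletionLocal` D♭):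
with the local depletion split `⟪ω,(∇u)ω⟫(x̄) ≤ |ω(x̄)|²·(A·∫_{B(x̄,ρ)} |ω_⊥| |x̄−y|⁻³ + 8A'(4π/(3(ρ/2)³))^{1/2}‖ω(t)‖₂)`
and `∫‖ω(t)‖₂ dt ≤ √(T−t₁)·√(C‖u(0)‖²₂/ν)` on every end slab, door S35-C's ONE-POINT hypothesis loses its
far field: only the NEAR-FIELD depletion integral around the argmax is charged.

* door S36-C♭ «ArgmaxNearCoherenceDoor» (fixed scale `R = r₀ > 0`, charged ball `B(x̄, 2R)` — the ball of
  D♭ `inner_stretching_le_local`): at every late CRITICAL argmax (`ε < (T−t)|ω(x̄,t)|`),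
  `(T − t)·(A·∫_{B(x̄,2r₀)} |ω(y) − ⟪ω(y),ξ(x̄)⟫ξ(x̄)| |x̄−y|⁻³ dy − ν|∇ξ(x̄)|²_F) ≤ a` (`a < 1`) ⇒ continuation.
  CLOSES from D♭ (landed, by name) + E♭ + N♭ + F (composition below, kernel-checked).
* door S36-C♯ «ArgmaxShrinkingCoherenceDoor» (scale `R = r₀(T−t)^β`, ball `B(x̄, 2R)`, `0 < β < 1/3` — the
  honest energy-class exponent: `∫^T (T−t)^{−3β} dt < ∞`): the same with the ball shrinking; plates E♭w (weighted
  engine) + N♭β (shrinking budget) — LEAD's `ArgmaxDoorsNearEngineWeighted`; composition kernel-checked.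
* support `hasSobolevExtensionPast_of_barrier_family`: the common real-variable end of both doors.

HONEST LABEL: bookkeeping (variant / new-combination): CF93's depletion seen from ONE point (door S35-C) with the
far field removed by Cauchy–Schwarz + the energy inequality; near-field print = Constantin–Fefferman 1993 (Lipschitz
coherence on the intense region), Grujić 2009 (localisation in a ball of fixed radius), Grujić–Ruzmaikina 2004.
WHAT THIS IS NOT: regularity CRITERIA about hypothetical blow-up; item 0056 `NoTypeII` / NS regularity NOT proved;
no Literature fact is a hypothesis; nothing here is a route or a summit statement (`--supports 0056 --as helper`).
-/

noncomputable section

open MeasureTheory Set Function Filter Metric Real InnerProductSpace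
open _root_.Topology
open scoped ENNReal NNReal RealInnerProductSpace ContDiff
open Literature.Analysis Literature.Analysis.FluidPDE
open Literature.Analysis.FluidPDE.VorticityDirectionDynamics

set_option linter.dupNamespace false

namespace Summit.NavierStokesRegularity.NavierStokesRegularity.Theorems.ArgmaxDoors

-- nested operator types (second derivatives)
set_option maxSynthPendingDepth 3

/-! ## §4 Support: the common real-variable end (proved) -/

section Support

variable {ν T t₀ a ε : ℝ} {u : ℝ → (EuclideanSpace ℝ (Fin 3)) → (EuclideanSpace ℝ (Fin 3))}
  {p : ℝ → (EuclideanSpace ℝ (Fin 3)) → ℝ}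

/-- support «barrier family ⇒ continuation» (proved): in the frame with `0 ≤ t₀ < T`, `a < 1`, `0 < ε < √3/4`, if
for every `η > 0` some end slab `[t₁,T)`, `t₁ ≥ t₀`, carries a barrier `|ω(x,t)| ≤ (ε/(T−t) + c(T−t)^{−a})(1 + η)`
(`c ≥ 0` may depend on `t₁`), then `u` continues past `T`: `(T−t)‖ω(t)‖_∞ ≤ (ε + c(T−t)^{1−a})(1+η) → ε(1+η)`, and
for `η` small this is `< √3/4` on a final interval, where the floor F applies. -/
theorem hasSobolevExtensionPast_of_barrier_family (hF : TypeISmallFloor) (hν : 0 < ν) (ht₀ : 0 ≤ t₀)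
    (ha : a < 1) (hε : 0 < ε) (hε' : ε < Real.sqrt 3 / 4)
    (hsol : IsClassicalNSSolutionOn (Ico 0 T) ν 0 u p)
    (hreg : ∀ T'' < T, HasBoundedSobolevNormsOn (Icc 0 T'') u)
    (hbar : ∀ η : ℝ, 0 < η → ∃ t₁ ∈ Ico t₀ T, ∃ c : ℝ, 0 ≤ c ∧ ∀ t ∈ Ico t₁ T, ∀ x,
      ‖curl (u t) x‖ ≤ (ε / (T - t) + c * (T - t) ^ (-a)) * (1 + η)) :
    HasSobolevExtensionPast ν u T := by
  set gap : ℝ := Real.sqrt 3 / 4 - ε with hgap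
  have hgap0 : 0 < gap := by rw [hgap]; linarith
  have h1a : 0 < 1 - a := by linarith
  -- `η` with `ε η ≤ gap/4`
  set η : ℝ := gap / (4 * (ε + 1)) with hη
  have hη0 : 0 < η := by positivity
  have hεη : ε * η ≤ gap / 4 := by
    rw [hη]
    have h1 : ε * (gap / (4 * (ε + 1))) = (ε / (ε + 1)) * (gap / 4) := by
      field_simp
    rw [h1]
    have h2 : ε / (ε + 1) ≤ 1 := (div_le_one (by positivity)).2 (by linarith)
    calc ε / (ε + 1) * (gap / 4) ≤ 1 * (gap / 4) := mul_le_mul_of_nonneg_right h2 (by positivity)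
      _ = gap / 4 := one_mul _
  obtain ⟨t₁, ht₁, c, hc0, hb⟩ := hbar η hη0
  -- the phase on `[t₁, T)`
  have hphase : ∀ t ∈ Ico t₁ T, (T - t) * supVorticity u t ≤ ε + gap / 4 + c * (1 + η) * (T - t) ^ (1 - a) := by
    intro t ht
    have hTt : 0 < T - t := sub_pos.2 ht.2
    have hb0 : 0 ≤ (ε / (T - t) + c * (T - t) ^ (-a)) * (1 + η) :=
      mul_nonneg (add_nonneg (div_pos hε hTt).le (mul_nonneg hc0 (Real.rpow_nonneg hTt.le _))) (by linarith)
    have hsup : supVorticity u t ≤ (ε / (T - t) + c * (T - t) ^ (-a)) * (1 + η) :=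
      supVorticity_le_of_forall_le hb0 (hb t ht)
    have heq : (T - t) * ((ε / (T - t) + c * (T - t) ^ (-a)) * (1 + η)) =
        (ε + c * (T - t) ^ (1 - a)) * (1 + η) := by
      have h1 : (T - t) * (ε / (T - t) + c * (T - t) ^ (-a)) = ε + c * (T - t) ^ (1 - a) := by
        rw [mul_add, mul_div_cancel₀ _ hTt.ne', Real.rpow_sub hTt, Real.rpow_one, Real.rpow_neg hTt.le]
        field_simp
      rw [← mul_assoc, h1]
    have hpow0 : 0 ≤ c * (T - t) ^ (1 - a) := mul_nonneg hc0 (Real.rpow_nonneg hTt.le _)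
    calc (T - t) * supVorticity u t ≤ (T - t) * ((ε / (T - t) + c * (T - t) ^ (-a)) * (1 + η)) :=
          mul_le_mul_of_nonneg_left hsup hTt.le
      _ = (ε + c * (T - t) ^ (1 - a)) * (1 + η) := heq
      _ = ε + ε * η + c * (1 + η) * (T - t) ^ (1 - a) := by ring
      _ ≤ ε + gap / 4 + c * (1 + η) * (T - t) ^ (1 - a) := by linarith
  -- the final interval: `c (1+η) (T−t)^{1−a} ≤ gap/4`
  set c₂ : ℝ := c * (1 + η) with hc₂
  have hc₂0 : 0 ≤ c₂ := mul_nonneg hc0 (by linarith)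
  set qq : ℝ := gap / 4 / (c₂ + 1) with hqq
  have hqq0 : 0 < qq := by positivity
  set δ : ℝ := qq ^ (1 / (1 - a)) with hδ
  have hδ0 : 0 < δ := Real.rpow_pos_of_pos hqq0 _
  have hδpow : δ ^ (1 - a) = qq := by
    rw [hδ, ← Real.rpow_mul hqq0.le, one_div_mul_cancel h1a.ne', Real.rpow_one]
  set t₂ : ℝ := max t₁ (T - δ) with ht₂
  have ht₂mem : t₂ ∈ Ico t₁ T := ⟨le_max_left _ _, max_lt ht₁.2 (by linarith)⟩
  have hsmall : ∀ t ∈ Ico t₂ T, (T - t) * supVorticity u t ≤ ε + gap / 2 := by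
    intro t ht
    have htt₁ : t ∈ Ico t₁ T := ⟨(le_max_left _ _).trans ht.1, ht.2⟩
    have hTt : 0 < T - t := sub_pos.2 ht.2
    have hle : T - t ≤ δ := by linarith [le_max_right t₁ (T - δ), ht.1]
    have hpow : (T - t) ^ (1 - a) ≤ qq := by
      rw [← hδpow]; exact Real.rpow_le_rpow hTt.le hle h1a.le
    have hcq : c₂ * (T - t) ^ (1 - a) ≤ gap / 4 := by
      calc c₂ * (T - t) ^ (1 - a) ≤ c₂ * qq := mul_le_mul_of_nonneg_left hpow hc₂0
        _ ≤ (c₂ + 1) * qq := mul_le_mul_of_nonneg_right (by linarith) hqq0.le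
        _ = gap / 4 := by rw [hqq]; field_simp
    have := hphase t htt₁
    linarith
  have ht₀t₂ : t₀ ≤ t₂ := ht₁.1.trans ht₂mem.1
  exact hF ν T t₂ (ε + gap / 2) hν (ht₀.trans ht₀t₂) ht₂mem.2 (by positivity)
    (by rw [hgap]; linarith) u p hsol hreg hsmall

-- (the sketch's local `exp_le_one_add_two_mul` is the landed
-- `Literature.NumberTheory.Sieve.exp_le_one_add_two_mul`; the gate's dedup rule requires citing it.)

/-- support: the local depletion split turns the door's near-field hypothesis into the engine's rate
`α − ν|∇ξ|²_F ≤ a/(T−s) + k‖ω(s)‖₂` at a critical argmax (`k = 8A'(4π/(3R³))^{1/2}`, charged ball `B(x̄,2R)`). -/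
theorem rate_le_of_near_hypothesis {A A' a R s : ℝ} {x : EuclideanSpace ℝ (Fin 3)}
    (hTs : 0 < T - s) (hx : curl (u s) x ≠ 0)
    (hdep : ⟪curl (u s) x, fderiv ℝ (u s) x (curl (u s) x)⟫ ≤ ‖curl (u s) x‖ ^ 2 *
      (A * (∫ y in ball x (2 * R), ‖curl (u s) y - ⟪curl (u s) y, vorticityDirection (curl (u s)) x⟫ •
          vorticityDirection (curl (u s)) x‖ * (‖x - y‖ ^ 3)⁻¹) +
        8 * A' * ((4 * π / (3 * R ^ 3)) ^ (1 / (2 : ℝ)) * (∫ y, ‖curl (u s) y‖ ^ 2) ^ (1 / (2 : ℝ)))))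
    (hdoor : (T - s) * (A * nearDepletionIntegral u s x (2 * R) -
      ν * frobeniusNormSq (fderiv ℝ (vorticityDirection (curl (u s))) x)) ≤ a) :
    ⟪vorticityDirection (curl (u s)) x, fderiv ℝ (u s) x (vorticityDirection (curl (u s)) x)⟫ -
        ν * frobeniusNormSq (fderiv ℝ (vorticityDirection (curl (u s))) x) ≤
      a / (T - s) + 8 * A' * (4 * π / (3 * R ^ 3)) ^ (1 / (2 : ℝ)) *
        (∫ y, ‖curl (u s) y‖ ^ 2) ^ (1 / (2 : ℝ)) := by
  set N : ℝ := nearDepletionIntegral u s x (2 * R) with hN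
  set Fr : ℝ := frobeniusNormSq (fderiv ℝ (vorticityDirection (curl (u s))) x) with hFr
  set L : ℝ := (∫ y, ‖curl (u s) y‖ ^ 2) ^ (1 / (2 : ℝ)) with hL
  set kk : ℝ := 8 * A' * (4 * π / (3 * R ^ 3)) ^ (1 / (2 : ℝ)) with hkk
  set w2 : ℝ := ‖curl (u s) x‖ ^ 2 with hw2
  have hw2nn : 0 ≤ w2 := sq_nonneg _
  have hdoor' : A * N - ν * Fr ≤ a / (T - s) := by
    rw [le_div_iff₀ hTs, mul_comm]; exact hdoor
  have hdep' : ⟪curl (u s) x, fderiv ℝ (u s) x (curl (u s) x)⟫ ≤ w2 * (A * N + kk * L) := by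
    have : w2 * (A * N + 8 * A' * ((4 * π / (3 * R ^ 3)) ^ (1 / (2 : ℝ)) * L)) = w2 * (A * N + kk * L) := by
      rw [hkk]; ring
    rw [← this]; exact hdep
  refine rate_le_of_netStretch_le hx (c := a / (T - s) + kk * L) ?_
  show netStretch ν u s x ≤ _
  have hns : netStretch ν u s x = ⟪curl (u s) x, fderiv ℝ (u s) x (curl (u s) x)⟫ - ν * w2 * Fr := by
    rw [hw2, hFr]; rfl
  rw [hns]
  have h1 : w2 * (A * N - ν * Fr) ≤ w2 * (a / (T - s)) := mul_le_mul_of_nonneg_left hdoor' hw2nn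
  calc ⟪curl (u s) x, fderiv ℝ (u s) x (curl (u s) x)⟫ - ν * w2 * Fr
        ≤ w2 * (A * N + kk * L) - ν * w2 * Fr := by linarith
    _ = w2 * (A * N - ν * Fr) + w2 * (kk * L) := by ring
    _ ≤ w2 * (a / (T - s)) + w2 * (kk * L) := by linarith
    _ = (a / (T - s) + kk * L) * w2 := by ring

end Support

/-! ## §5 Compositions (kernel-checked) -/

/-- **Door S36-C♭ from the plates**: `LocalDepletion → NearEngine → SlabDissipationBudget → TypeISmallFloor →
ArgmaxNearCoherenceDoor`. For `η > 0`: with `k = 8A'(4π/(3r₀³))^{1/2}`, `Q = √(C‖u(0)‖²₂/ν)`, choose the slab start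
`t₁ ≥ t₀` with `kQ√(T−t₁) ≤ min 1 (η/2)`; at a critical argmax on `(t₁,t]` the door + D♭ (at `R = r₀`) give the rate
`a/(T−s) + k‖ω(s)‖₂`; E♭ from `t₁` (with `c = ‖ω(t₁)‖_∞(T−t₁)^a`) and N♭ give the barrier
`(ε/(T−t) + c(T−t)^{−a})·e^{kQ√(T−t₁)} ≤ (…)(1+η)`; the support lemma ends it. -/
theorem argmaxNearCoherenceDoor_of (hD : LocalDepletion) (hE : NearEngine) (hN : SlabDissipationBudget)
    (hF : TypeISmallFloor) : ArgmaxNearCoherenceDoor := by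
  obtain ⟨A, A', hA, hA', hdep⟩ := hD
  obtain ⟨C, hC, hbud⟩ := hN
  refine ⟨A, hA, ?_⟩
  intro ν T t₀ a ε r₀ hν ht₀ ht₀T ha hε hε' hr₀ u p hsol hreg hhyp
  set k : ℝ := 8 * A' * (4 * π / (3 * r₀ ^ 3)) ^ (1 / (2 : ℝ)) with hk
  have hk0 : 0 ≤ k := by rw [hk]; exact mul_nonneg (by positivity) (Real.rpow_nonneg (by positivity) _)
  set E₀ : ℝ := ∫ y, ‖u 0 y‖ ^ 2 with hE₀
  set Q : ℝ := Real.sqrt (C * E₀ / ν) with hQ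
  have hQ0 : 0 ≤ Q := Real.sqrt_nonneg _
  -- ### the barrier on `[t₁, T)` for every slab start `t₁ ∈ [t₀, T)`
  have hbound : ∀ t₁ ∈ Ico t₀ T, ∀ t ∈ Ico t₁ T, ∀ x,
      ‖curl (u t) x‖ ≤ (ε / (T - t) + supVorticity u t₁ * (T - t₁) ^ a * (T - t) ^ (-a)) *
        Real.exp (k * Q * Real.sqrt (T - t₁)) := by
    intro t₁ ht₁ t ht x
    have hTt₁ : 0 < T - t₁ := sub_pos.2 ht₁.2
    have ht₁0 : 0 ≤ t₁ := ht₀.trans ht₁.1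
    set c : ℝ := supVorticity u t₁ * (T - t₁) ^ a with hc
    have hc0 : 0 ≤ c := mul_nonneg (supVorticity_nonneg u t₁) (Real.rpow_nonneg hTt₁.le a)
    -- rate hypothesis on `(t₁, t]`
    have hrate : ∀ s ∈ Ioc t₁ t, ∀ y, IsVorticityArgmax u s y → ε < (T - s) * ‖curl (u s) y‖ →
        ⟪vorticityDirection (curl (u s)) y, fderiv ℝ (u s) y (vorticityDirection (curl (u s)) y)⟫ -
            ν * frobeniusNormSq (fderiv ℝ (vorticityDirection (curl (u s))) y) ≤
          a / (T - s) + k * (∫ z, ‖curl (u s) z‖ ^ 2) ^ (1 / (2 : ℝ)) := by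
      intro s hs y hy hεs
      have hsT : s < T := hs.2.trans_lt ht.2
      have hTs : 0 < T - s := sub_pos.2 hsT
      have hs0T : s ∈ Ico 0 T := ⟨ht₁0.trans hs.1.le, hsT⟩
      have hst₀ : s ∈ Ico t₀ T := ⟨ht₁.1.trans hs.1.le, hsT⟩
      have hy0 : curl (u s) y ≠ 0 := by
        intro h0; rw [h0, norm_zero, mul_zero] at hεs; exact absurd hεs (not_lt.2 hε.le)
      have hD' := (hdep ν T u p hsol hreg s hs0T y hy0 r₀ hr₀).2
      have hh := hhyp s hst₀ y hy hεs
      have := rate_le_of_near_hypothesis (T := T) (ν := ν) (u := u) hTs hy0 hD' hh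
      simpa [hk] using this
    have hinit : ∀ y, ‖curl (u t₁) y‖ ≤ ε / (T - t₁) + c * (T - t₁) ^ (-a) := by
      intro y
      have h1 : ‖curl (u t₁) y‖ ≤ supVorticity u t₁ := norm_curl_le_supVorticity hsol hreg ⟨ht₁0, ht₁.2⟩ y
      have h2 : c * (T - t₁) ^ (-a) = supVorticity u t₁ := by
        rw [hc, mul_assoc, ← Real.rpow_add hTt₁, add_neg_cancel, Real.rpow_zero, mul_one]
      have h3 : 0 ≤ ε / (T - t₁) := (div_pos hε hTt₁).le
      linarith
    have hmain := hE ν T u p hν hsol hreg t₁ t a ε c k ht₁0 ht.1 ht.2 ha.le hε hc0 hk0 hrate hinit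
      t ⟨ht.1, le_rfl⟩ x
    -- the exponent: `k ∫_{t₁}^{t} ‖ω‖₂ ≤ k Q √(T − t₁)`
    have hI := hbud ν T u p hν hsol hreg t₁ t ht₁0 ht.1 ht.2
    have hexp : Real.exp (k * ∫ r in t₁..t, (∫ y, ‖curl (u r) y‖ ^ 2) ^ (1 / (2 : ℝ))) ≤
        Real.exp (k * Q * Real.sqrt (T - t₁)) := by
      refine Real.exp_le_exp.2 ?_
      have hsq : Real.sqrt (t - t₁) ≤ Real.sqrt (T - t₁) := Real.sqrt_le_sqrt (by linarith [ht.2])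
      calc k * ∫ r in t₁..t, (∫ y, ‖curl (u r) y‖ ^ 2) ^ (1 / (2 : ℝ))
            ≤ k * (Real.sqrt (t - t₁) * Q) := mul_le_mul_of_nonneg_left (by rw [hQ, hE₀]; exact hI) hk0
        _ ≤ k * (Real.sqrt (T - t₁) * Q) :=
            mul_le_mul_of_nonneg_left (mul_le_mul_of_nonneg_right hsq hQ0) hk0
        _ = k * Q * Real.sqrt (T - t₁) := by ring
    have hTt : 0 < T - t := sub_pos.2 ht.2
    have hB0 : 0 ≤ ε / (T - t) + c * (T - t) ^ (-a) :=
      add_nonneg (div_pos hε hTt).le (mul_nonneg hc0 (Real.rpow_nonneg hTt.le _))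
    exact hmain.trans (mul_le_mul_of_nonneg_left hexp hB0)
  -- ### for `η > 0` a slab start with `exp(kQ√(T−t₁)) ≤ 1 + η`
  refine hasSobolevExtensionPast_of_barrier_family hF hν ht₀ ha hε hε' hsol hreg fun η hη => ?_
  set x₀ : ℝ := min 1 (η / 2) with hx₀
  have hx₀0 : 0 < x₀ := lt_min one_pos (by positivity)
  have hx₀1 : x₀ ≤ 1 := min_le_left _ _
  have hx₀η : x₀ ≤ η / 2 := min_le_right _ _
  set d : ℝ := (x₀ / (k * Q + 1)) ^ 2 with hd
  have hkQ : 0 < k * Q + 1 := by positivity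
  have hd0 : 0 < d := by positivity
  set t₁ : ℝ := max t₀ (T - d) with ht₁
  have ht₁mem : t₁ ∈ Ico t₀ T := ⟨le_max_left _ _, max_lt ht₀T (by linarith)⟩
  have hTt₁ : 0 < T - t₁ := sub_pos.2 ht₁mem.2
  have hsq : Real.sqrt (T - t₁) ≤ x₀ / (k * Q + 1) := by
    have hle : T - t₁ ≤ d := by linarith [le_max_right t₀ (T - d)]
    calc Real.sqrt (T - t₁) ≤ Real.sqrt d := Real.sqrt_le_sqrt hle
      _ = x₀ / (k * Q + 1) := by rw [hd, Real.sqrt_sq (div_pos hx₀0 hkQ).le]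
  have hexp1 : k * Q * Real.sqrt (T - t₁) ≤ x₀ := by
    calc k * Q * Real.sqrt (T - t₁) ≤ k * Q * (x₀ / (k * Q + 1)) :=
          mul_le_mul_of_nonneg_left hsq (mul_nonneg hk0 hQ0)
      _ = x₀ * (k * Q / (k * Q + 1)) := by ring
      _ ≤ x₀ * 1 := mul_le_mul_of_nonneg_left ((div_le_one hkQ).2 (by linarith)) hx₀0.le
      _ = x₀ := mul_one _
  have hexp0 : 0 ≤ k * Q * Real.sqrt (T - t₁) := mul_nonneg (mul_nonneg hk0 hQ0) (Real.sqrt_nonneg _)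
  have hexpη : Real.exp (k * Q * Real.sqrt (T - t₁)) ≤ 1 + η := by
    calc Real.exp (k * Q * Real.sqrt (T - t₁)) ≤ 1 + 2 * (k * Q * Real.sqrt (T - t₁)) :=
          Literature.NumberTheory.Sieve.exp_le_one_add_two_mul hexp0 (hexp1.trans hx₀1)
      _ ≤ 1 + 2 * x₀ := by linarith
      _ ≤ 1 + η := by linarith
  refine ⟨t₁, ht₁mem, supVorticity u t₁ * (T - t₁) ^ a,
    mul_nonneg (supVorticity_nonneg u t₁) (Real.rpow_nonneg hTt₁.le a), fun t ht x => ?_⟩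
  have hTt : 0 < T - t := sub_pos.2 ht.2
  have hB0 : 0 ≤ ε / (T - t) + supVorticity u t₁ * (T - t₁) ^ a * (T - t) ^ (-a) :=
    add_nonneg (div_pos hε hTt).le (mul_nonneg (mul_nonneg (supVorticity_nonneg u t₁)
      (Real.rpow_nonneg hTt₁.le a)) (Real.rpow_nonneg hTt.le _))
  exact (hbound t₁ ht₁mem t ht x).trans (mul_le_mul_of_nonneg_left hexpη hB0)

end Summit.NavierStokesRegularity.NavierStokesRegularity.Theorems.ArgmaxDoors

end
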